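import Summits.QuantumFields.YangMills.Theorems.BalabanUVNodesN15KingModelFreeRGThm34Letters
import HarnessLib

/-!
# BalabanUVNodes ∕ N15 — THE KING-MODEL RUNG, FREE-FIELD EDITION (PART Τ-f): [King1986] **THEOREM 3.4 (3.9) BY NAME** —
# `RGData.Thm34Printed (kingFreeRG L M₀ a m² b₀ p)`: for the free massive lattice scalar field at `A = 0`,
# `χ_k(φ_k)·|S^{(k),1}(T₁^{(k)}, φ_k) − S^{(k+n),1}(T₁^{(k)}, φ_k)| ≤ C(L^{−γk}(L^kε_K)^{−β} + (L^kε_K)^σ)|T|` for ALL `K, k, n, φ_k`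
# — King's §3.6 (3.91)–(3.93) route, the normalisation difference done WITHOUT determinants
# (Track A, DAG node N15 = NE2; FAN-OUT v1.1 §N15 s3 «KING-MODEL RUNG»; regen R453 (b))

HONEST FRAMING.  Count-neutral (cell `pub-ymgap`, seat `pub-ymgap-dag-n15-e` g19; `--supports stmt-QuantumFields-27366 --as helper` = K3⁸
`SpineGivenEndpointR13SepCoPHV`).  TEMPLATE LITERATURE, `A = 0`: [King1986] Theorem 3.4 p. 656 (*"The following theorem is the core of this paper"*) is
PRINTED and proved there for the U(1) Higgs model in `d = 2, 3`; here it is decided for the FREE-FIELD datum of part Τ-e (King's (2.4)–(2.6) with the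
gauge field, `λ`, counterterms and sources off), for which King's own proof reduces to §3.6 p. 668–669: the quadratic term by Prop. 3.10 (3.91)–(3.92)
and the Gaussian normalisations by (3.93).  INPUTS BY NAME: part Τ-d `kingEffLap_forms_rate` (Prop. 3.10 AS FORMS, from the typer's `lemma43_aK` +
`effLaplacian_form_DeltaEff`, zero mode included), `kingEffLap_form_le` ∕ `kingEffLap_coercive` ∕ `lapF_form_le` ∕ `lapF_coercive_floor` (the sandwich), part
Τ-a `abs_log_gaussNorm_sub_le` ((3.93)'s right-hand side `CL^{−2k}·(L^kε)^{−d}|T|` from the form comparison and Lebesgue scaling — NO determinant) and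
`abs_log_gaussNorm_sub_le_crude` (the rate-free members).  THE PROOF, per `(m, k, n, φ)` with `χ = 1` (else the left side is `0`): `k, n ≥ 1`:
`|½⟨φ,(Δ^{(k)}−Δ^{(k+n)})φ⟩| ≤ ½θ_k⟨φ,Δ^{(k)}φ⟩ ≤ ½Θ L^{−2k}·a·|T₁^{(k)}|·R_m²` ((3.92): on `χ = 1`, `Σ_yφ(y)² ≤ |T₁^{(k)}|R_m²`, `R_m` the threshold) and
`|ln 𝒩(Δ^{(k)}) − ln 𝒩(Δ^{(k+n)})| ≤ |T₁^{(k)}|·Θ L^{−2k}·Λ_m` ((3.93); `Λ_m` absorbs the finitely many `k` with `Θ L^{−2k} > ½` through the crude sandwich);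
`k = 0` (bare action vs. `Δ^{(n)}`, rate factor `L^{0} = 1`) and `n = 0` (zero) are the rate-free members; then `|T₁^{(k)}| = ε_m^{−d}|T|`, `m²ε_m²`,
`R_m² ≤ b₀²L^{2p+2}ε_m^{−2p−2}`, `|ln A|, |ln δ| ≤ Λ₀ε_m^{−2}` give (3.9) with `γ = ½`, `σ = 1`, `β = d + 2p + 2` and an explicit `C(a, L, m², b₀, p, d)`.
HONEST SCOPE: datum of part Τ-e (cubic torus, `h = g = 0`, φ-clause of (3.2) at `λ := 1`, `S^{(k),1}` in closed Gaussian form); `L ≥ 2`, `a, m², b₀ > 0`,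
`p ≥ 0`, ANY dimension `d` (the threshold's exponent `(4−d)∕4 ≤ 1` is all that is used); King's `γ` may be any number in `(0,1)` here (the model's rate is
`L^{−2k}`), we display `γ = ½`; the `+ (L^kε)^σ|T|` member of (3.9) is not needed and carried with `σ = 1`.  NOT Bałaban's objects; NOT the interacting
Higgs model's (3.9) (no `P^{(k),1}`, no renormalization cancellations §3.4–3.5); NOT a node discharge; nothing continuum-YM ∕ ℝ⁴ ∕ OS ∕ mass-gap ∕ Clay.
0 `sorry`; ONE reducible abbreviation (`thm34Const`, the explicit constant `C`); standard axioms.  Letters: part Τ-f₁ `…FreeRGThm34Letters`.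
Locators: [King1986] (3.1)–(3.2) p.655, Thm 3.4 (3.9) p.656, (3.14) p.657, Prop. 3.10 (3.91)–(3.93) pp.668–669.
-/

noncomputable section

namespace Summit.QuantumFields.YangMills.BalabanUVNodes.N15KingModelRung.FreeField

open Real Finset Matrix MeasureTheory
open Literature.MathematicalPhysics.QuantumFieldTheory.Balaban1983to89 (B2.pFn)
open Literature.MathematicalPhysics.QuantumFieldTheory.Balaban1983to89.B5Prop11Plancherel (Tor)
open Literature.MathematicalPhysics.QuantumFieldTheory.Balaban1983to89.QGQInverse (Coercive)
open Literature.LinearAlgebra.Matrix (dotProduct_self_nonneg_real)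
open Literature.MathematicalPhysics.QuantumFieldTheory.King1986.Torus (lapF)
open Literature.MathematicalPhysics.QuantumFieldTheory.King1986.ContinuumLimit (eps eps_pos eps_le_one RGData)

variable {d : ℕ}

/-! ## §5 ★★★ THEOREM 3.4 BY NAME -/

section Main

variable (L : ℕ) [NeZero L] (M₀ : ℕ) [NeZero M₀]

/-- **The constant of (3.9) for the free field**: `C = (Θ + 1)·(½(a + m² + 4d + 1)b₀²L^{2p+2} + Λ₀)` (explicit in `a, L, m², b₀, p, d`). [folklore] -/
abbrev thm34Const (a : ℝ) (L : ℕ) (msq b₀ p : ℝ) (d : ℕ) : ℝ :=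
  (thetaUnif a L + 1) * ((1 : ℝ) / 2 * (a + msq + 4 * d + 1) * (b₀ ^ 2 * (L : ℝ) ^ (2 * p + 2)) + lambda0 a L msq d)

omit [NeZero L] in
/-- `L^{−2k} ≤ L^{−k∕2}` as the schema's `rpow` (`L ≥ 1`). [folklore] -/
theorem rate_le_rpow (hL : 2 ≤ L) (k : ℕ) : ((L : ℝ) ^ (2 * k))⁻¹ ≤ (L : ℝ) ^ (-((1 : ℝ) / 2 * k)) := by
  have hL1 : (1 : ℝ) ≤ L := by exact_mod_cast (show 1 ≤ L by omega)
  have hL0 : (0 : ℝ) < L := by linarith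
  have hk : (0 : ℝ) ≤ k := Nat.cast_nonneg k
  rw [Real.rpow_neg hL0.le]
  apply inv_anti₀ (Real.rpow_pos_of_pos hL0 _)
  have hexp : (1 : ℝ) / 2 * k ≤ ((2 * k : ℕ) : ℝ) := by push_cast; linarith
  calc (L : ℝ) ^ ((1 : ℝ) / 2 * k) ≤ (L : ℝ) ^ ((2 * k : ℕ) : ℝ) := Real.rpow_le_rpow_of_exponent_le hL1 hexp
    _ = (L : ℝ) ^ (2 * k) := Real.rpow_natCast _ _

omit [NeZero L] in
/-- The constant dominates both members' letters. [folklore] -/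
theorem thm34Const_ge {a : ℝ} (ha : 0 < a) (hL : 2 ≤ L) {msq b₀ p : ℝ} (hmsq : 0 < msq) :
    thetaUnif a L * ((1 : ℝ) / 2 * a * (b₀ ^ 2 * (L : ℝ) ^ (2 * p + 2)) + lambda0 a L msq d) ≤ thm34Const a L msq b₀ p d ∧
      (1 : ℝ) / 2 * (a + msq + 4 * d + 1) * (b₀ ^ 2 * (L : ℝ) ^ (2 * p + 2)) + lambda0 a L msq d ≤ thm34Const a L msq b₀ p d := by
  have hΘ := thetaUnif_pos ha hL
  have h1L := one_sub_invSq_pos hL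
  have hamin : 0 < a * (1 - ((L : ℝ) ^ 2)⁻¹) := mul_pos ha h1L
  have hΛ0 : 0 < lambda0 a L msq d := by unfold lambda0; positivity
  have hB0 : 0 ≤ b₀ ^ 2 * (L : ℝ) ^ (2 * p + 2) := by positivity
  have hd0 : (0 : ℝ) ≤ 4 * d := by positivity
  set B : ℝ := b₀ ^ 2 * (L : ℝ) ^ (2 * p + 2)
  have hX0 : 0 ≤ (1 : ℝ) / 2 * (a + msq + 4 * d + 1) * B + lambda0 a L msq d := by positivity
  have hXY : (1 : ℝ) / 2 * a * B + lambda0 a L msq d ≤ (1 : ℝ) / 2 * (a + msq + 4 * d + 1) * B + lambda0 a L msq d := by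
    have : (1 : ℝ) / 2 * a * B ≤ (1 : ℝ) / 2 * (a + msq + 4 * d + 1) * B := by
      apply mul_le_mul_of_nonneg_right _ hB0; linarith
    linarith
  unfold thm34Const
  constructor
  · calc thetaUnif a L * ((1 : ℝ) / 2 * a * B + lambda0 a L msq d)
        ≤ thetaUnif a L * ((1 : ℝ) / 2 * (a + msq + 4 * d + 1) * B + lambda0 a L msq d) := mul_le_mul_of_nonneg_left hXY hΘ.le
      _ ≤ (thetaUnif a L + 1) * ((1 : ℝ) / 2 * (a + msq + 4 * d + 1) * B + lambda0 a L msq d) :=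
          mul_le_mul_of_nonneg_right (by linarith) hX0
  · calc (1 : ℝ) / 2 * (a + msq + 4 * d + 1) * B + lambda0 a L msq d
        = 1 * ((1 : ℝ) / 2 * (a + msq + 4 * d + 1) * B + lambda0 a L msq d) := (one_mul _).symm
      _ ≤ (thetaUnif a L + 1) * ((1 : ℝ) / 2 * (a + msq + 4 * d + 1) * B + lambda0 a L msq d) :=
          mul_le_mul_of_nonneg_right (by linarith) hX0

/-- The second summand of both members: `|T₁^{(k)}|·Λ ≤ |T|·Λ₀·ε_m^{−(d+2p+2)}`. [folklore] -/
theorem card_lambda_le {a msq : ℝ} (ha : 0 < a) (hL : 2 ≤ L) (hmsq : 0 < msq) {p : ℝ} (hp : 0 ≤ p) (m : ℕ) :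
    (Fintype.card (Tor (cubeSide (d := d) M₀ L m)) : ℝ)
        * (1 + |Real.log (a + unitMassSq msq L m + 4 * d)| + |Real.log (deltaFloor a L (unitMassSq msq L m))|)
      ≤ (M₀ : ℝ) ^ d * lambda0 a L msq d * eps L m ^ (-((d : ℝ) + 2 * p + 2)) := by
  have hε : 0 < eps L m := eps_pos (by omega) m
  have hΛ := lambda_le (d := d) L ha hL hmsq m
  have hεd2 : eps L m ^ (-(d : ℝ)) * eps L m ^ (-(2 : ℝ)) ≤ eps L m ^ (-((d : ℝ) + 2 * p + 2)) := by
    rw [← Real.rpow_add hε, ← neg_add]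
    exact eps_rpow_neg_mono L hL m (by linarith)
  have h1L := one_sub_invSq_pos hL
  have hamin : 0 < a * (1 - ((L : ℝ) ^ 2)⁻¹) := mul_pos ha h1L
  have hΛ0 : 0 < lambda0 a L msq d := by unfold lambda0; positivity
  rw [card_cube_rpow L M₀ hL m]
  calc (M₀ : ℝ) ^ d * eps L m ^ (-(d : ℝ))
        * (1 + |Real.log (a + unitMassSq msq L m + 4 * d)| + |Real.log (deltaFloor a L (unitMassSq msq L m))|)
      ≤ (M₀ : ℝ) ^ d * eps L m ^ (-(d : ℝ)) * (lambda0 a L msq d * eps L m ^ (-(2 : ℝ))) := mul_le_mul_of_nonneg_left hΛ (by positivity)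
    _ = (M₀ : ℝ) ^ d * lambda0 a L msq d * (eps L m ^ (-(d : ℝ)) * eps L m ^ (-(2 : ℝ))) := by ring
    _ ≤ _ := mul_le_mul_of_nonneg_left hεd2 (by positivity)

/-- **The rated member in `ε`-letters**: `k, n ≥ 1`, `χ = 1` ⇒ `|S^{(k),1} − S^{(k+n),1}| ≤ C·L^{−k∕2}ε_m^{−(d+2p+2)}·|T|`. [cite: King1986, (3.9) p.656] -/
theorem thm34_member_rate {a msq b₀ p : ℝ} (ha : 0 < a) (hL : 2 ≤ L) (hmsq : 0 < msq) (hb : 0 ≤ b₀) (hp : 0 ≤ p) (m : ℕ) {k n : ℕ}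
    (hk : 1 ≤ k) (hn : 1 ≤ n) {φ : Tor (cubeSide (d := d) M₀ L m) → ℝ} (hχ : kingFreeChi L M₀ b₀ p m φ = 1) :
    |kingFreeS L M₀ a msq m k φ - kingFreeS L M₀ a msq m (k + n) φ|
      ≤ thm34Const a L msq b₀ p d * ((L : ℝ) ^ (-((1 : ℝ) / 2 * k)) * eps L m ^ (-((d : ℝ) + 2 * p + 2))) * (M₀ : ℝ) ^ d := by
  have hε : 0 < eps L m := eps_pos (by omega) m
  have hΘ := thetaUnif_pos ha hL
  have hmem := kingFreeS_diff_rate (d := d) L M₀ ha hL hmsq m hk hn φ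
  have hφφ := dotProduct_self_le_eps L M₀ hL hb hp hχ
  have hcardΛ := card_lambda_le (d := d) L M₀ ha hL hmsq hp m
  have htrate : thetaUnif a L * ((L : ℝ) ^ (2 * k))⁻¹ ≤ thetaUnif a L * (L : ℝ) ^ (-((1 : ℝ) / 2 * k)) :=
    mul_le_mul_of_nonneg_left (rate_le_rpow L hL k) hΘ.le
  obtain ⟨hK, _⟩ := thm34Const_ge (d := d) L ha hL (b₀ := b₀) (p := p) hmsq
  have hin0 : 0 ≤ (1 : ℝ) / 2 * a * (φ ⬝ᵥ φ) + (Fintype.card (Tor (cubeSide (d := d) M₀ L m)) : ℝ)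
        * (1 + |Real.log (a + unitMassSq msq L m + 4 * d)| + |Real.log (deltaFloor a L (unitMassSq msq L m))|) := by
    have := dotProduct_self_nonneg_real φ; positivity
  have hin : (1 : ℝ) / 2 * a * (φ ⬝ᵥ φ) + (Fintype.card (Tor (cubeSide (d := d) M₀ L m)) : ℝ)
          * (1 + |Real.log (a + unitMassSq msq L m + 4 * d)| + |Real.log (deltaFloor a L (unitMassSq msq L m))|)
      ≤ ((1 : ℝ) / 2 * a * (b₀ ^ 2 * (L : ℝ) ^ (2 * p + 2)) + lambda0 a L msq d) * ((M₀ : ℝ) ^ d * eps L m ^ (-((d : ℝ) + 2 * p + 2))) := by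
    have h1 : (1 : ℝ) / 2 * a * (φ ⬝ᵥ φ)
        ≤ (1 : ℝ) / 2 * a * ((M₀ : ℝ) ^ d * (b₀ ^ 2 * (L : ℝ) ^ (2 * p + 2)) * eps L m ^ (-((d : ℝ) + 2 * p + 2))) :=
      mul_le_mul_of_nonneg_left hφφ (by positivity)
    refine (add_le_add h1 hcardΛ).trans (le_of_eq ?_); ring
  have hrate0 : 0 ≤ (L : ℝ) ^ (-((1 : ℝ) / 2 * k)) := Real.rpow_nonneg (Nat.cast_nonneg L) _
  refine hmem.trans ?_
  calc thetaUnif a L * ((L : ℝ) ^ (2 * k))⁻¹ * ((1 : ℝ) / 2 * a * (φ ⬝ᵥ φ) + (Fintype.card (Tor (cubeSide (d := d) M₀ L m)) : ℝ)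
          * (1 + |Real.log (a + unitMassSq msq L m + 4 * d)| + |Real.log (deltaFloor a L (unitMassSq msq L m))|))
      ≤ (thetaUnif a L * (L : ℝ) ^ (-((1 : ℝ) / 2 * k)))
          * (((1 : ℝ) / 2 * a * (b₀ ^ 2 * (L : ℝ) ^ (2 * p + 2)) + lambda0 a L msq d) * ((M₀ : ℝ) ^ d * eps L m ^ (-((d : ℝ) + 2 * p + 2)))) :=
        mul_le_mul htrate hin hin0 (by positivity)
    _ = (thetaUnif a L * ((1 : ℝ) / 2 * a * (b₀ ^ 2 * (L : ℝ) ^ (2 * p + 2)) + lambda0 a L msq d))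
          * (((L : ℝ) ^ (-((1 : ℝ) / 2 * k)) * eps L m ^ (-((d : ℝ) + 2 * p + 2))) * (M₀ : ℝ) ^ d) := by ring
    _ ≤ thm34Const a L msq b₀ p d * (((L : ℝ) ^ (-((1 : ℝ) / 2 * k)) * eps L m ^ (-((d : ℝ) + 2 * p + 2))) * (M₀ : ℝ) ^ d) :=
        mul_le_mul_of_nonneg_right hK (by positivity)
    _ = _ := by ring

/-- **The rate-free member in `ε`-letters**: `k = 0`, `n ≥ 1`, `χ = 1` ⇒ `|S^{(0),1} − S^{(n),1}| ≤ C·ε_m^{−(d+2p+2)}·|T|`. [cite: King1986, (3.9) p.656] -/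
theorem thm34_member_zero {a msq b₀ p : ℝ} (ha : 0 < a) (hL : 2 ≤ L) (hmsq : 0 < msq) (hb : 0 ≤ b₀) (hp : 0 ≤ p) (m : ℕ) {n : ℕ}
    (hn : 1 ≤ n) {φ : Tor (cubeSide (d := d) M₀ L m) → ℝ} (hχ : kingFreeChi L M₀ b₀ p m φ = 1) :
    |kingFreeS L M₀ a msq m 0 φ - kingFreeS L M₀ a msq m n φ|
      ≤ thm34Const a L msq b₀ p d * eps L m ^ (-((d : ℝ) + 2 * p + 2)) * (M₀ : ℝ) ^ d := by
  have hε : 0 < eps L m := eps_pos (by omega) m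
  have hε1 : eps L m ≤ 1 := eps_le_one (by omega) m
  have hmem := kingFreeS_diff_zero (d := d) L M₀ ha hL hmsq m hn φ
  have hφφ := dotProduct_self_le_eps L M₀ hL hb hp hχ
  have hhalf := half_log_sub_le (d := d) L ha hL hmsq m
  obtain ⟨_, hK⟩ := thm34Const_ge (d := d) L ha hL (b₀ := b₀) (p := p) hmsq
  have hd0 : (0 : ℝ) ≤ 4 * d := by positivity
  have hm2 : 0 < unitMassSq msq L m := by unfold unitMassSq; exact mul_pos hmsq (pow_pos hε 2)
  have hm2le : unitMassSq msq L m ≤ msq := by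
    unfold unitMassSq; exact mul_le_of_le_one_right hmsq.le (pow_le_one₀ hε.le hε1)
  have hεd2 : eps L m ^ (-(d : ℝ)) * eps L m ^ (-(2 : ℝ)) ≤ eps L m ^ (-((d : ℝ) + 2 * p + 2)) := by
    rw [← Real.rpow_add hε, ← neg_add]
    exact eps_rpow_neg_mono L hL m (by linarith)
  -- first summand
  have hA1 : (1 : ℝ) / 2 * (a + unitMassSq msq L m + 4 * d) * (φ ⬝ᵥ φ)
      ≤ (1 : ℝ) / 2 * (a + msq + 4 * d + 1) * ((M₀ : ℝ) ^ d * (b₀ ^ 2 * (L : ℝ) ^ (2 * p + 2)) * eps L m ^ (-((d : ℝ) + 2 * p + 2))) := by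
    have hc1 : (0 : ℝ) ≤ (1 : ℝ) / 2 * (a + unitMassSq msq L m + 4 * d) := by positivity
    have hc2 : (1 : ℝ) / 2 * (a + unitMassSq msq L m + 4 * d) ≤ (1 : ℝ) / 2 * (a + msq + 4 * d + 1) := by linarith
    exact (mul_le_mul_of_nonneg_left hφφ hc1).trans (mul_le_mul_of_nonneg_right hc2 (by positivity))
  -- second summand
  have hA2 : (Fintype.card (Tor (cubeSide (d := d) M₀ L m)) : ℝ) / 2
        * (Real.log (a + unitMassSq msq L m + 4 * d) - Real.log (deltaFloor a L (unitMassSq msq L m)))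
      ≤ (M₀ : ℝ) ^ d * lambda0 a L msq d * eps L m ^ (-((d : ℝ) + 2 * p + 2)) := by
    rw [card_cube_rpow L M₀ hL m]
    have e : (M₀ : ℝ) ^ d * eps L m ^ (-(d : ℝ)) / 2 * (Real.log (a + unitMassSq msq L m + 4 * d) - Real.log (deltaFloor a L (unitMassSq msq L m)))
        = (M₀ : ℝ) ^ d * eps L m ^ (-(d : ℝ))
          * ((1 : ℝ) / 2 * (Real.log (a + unitMassSq msq L m + 4 * d) - Real.log (deltaFloor a L (unitMassSq msq L m)))) := by ring
    rw [e]
    calc (M₀ : ℝ) ^ d * eps L m ^ (-(d : ℝ))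
          * ((1 : ℝ) / 2 * (Real.log (a + unitMassSq msq L m + 4 * d) - Real.log (deltaFloor a L (unitMassSq msq L m))))
        ≤ (M₀ : ℝ) ^ d * eps L m ^ (-(d : ℝ)) * (lambda0 a L msq d * eps L m ^ (-(2 : ℝ))) := mul_le_mul_of_nonneg_left hhalf (by positivity)
      _ = (M₀ : ℝ) ^ d * lambda0 a L msq d * (eps L m ^ (-(d : ℝ)) * eps L m ^ (-(2 : ℝ))) := by ring
      _ ≤ _ := by
          have h1L := one_sub_invSq_pos hL
          have hamin : 0 < a * (1 - ((L : ℝ) ^ 2)⁻¹) := mul_pos ha h1L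
          have hΛ0 : 0 < lambda0 a L msq d := by unfold lambda0; positivity
          exact mul_le_mul_of_nonneg_left hεd2 (by positivity)
  refine hmem.trans ((add_le_add hA1 hA2).trans ?_)
  have key : (1 : ℝ) / 2 * (a + msq + 4 * d + 1) * ((M₀ : ℝ) ^ d * (b₀ ^ 2 * (L : ℝ) ^ (2 * p + 2)) * eps L m ^ (-((d : ℝ) + 2 * p + 2)))
        + (M₀ : ℝ) ^ d * lambda0 a L msq d * eps L m ^ (-((d : ℝ) + 2 * p + 2))
      = ((1 : ℝ) / 2 * (a + msq + 4 * d + 1) * (b₀ ^ 2 * (L : ℝ) ^ (2 * p + 2)) + lambda0 a L msq d)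
        * (eps L m ^ (-((d : ℝ) + 2 * p + 2)) * (M₀ : ℝ) ^ d) := by ring
  rw [key]
  calc ((1 : ℝ) / 2 * (a + msq + 4 * d + 1) * (b₀ ^ 2 * (L : ℝ) ^ (2 * p + 2)) + lambda0 a L msq d) * (eps L m ^ (-((d : ℝ) + 2 * p + 2)) * (M₀ : ℝ) ^ d)
      ≤ thm34Const a L msq b₀ p d * (eps L m ^ (-((d : ℝ) + 2 * p + 2)) * (M₀ : ℝ) ^ d) := mul_le_mul_of_nonneg_right hK (by positivity)
    _ = _ := by ring

/-- **All members**: `χ·|S^{(k),1} − S^{(k+n),1}| ≤ C·(L^{−k∕2}ε_m^{−(d+2p+2)} + ε_m)·|T|` for ALL `m, k, n, φ`. [cite: King1986, Thm 3.4 (3.9) p.656] -/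
theorem thm34_bound {a msq b₀ p : ℝ} (ha : 0 < a) (hL : 2 ≤ L) (hmsq : 0 < msq) (hb : 0 ≤ b₀) (hp : 0 ≤ p) (m k n : ℕ)
    (φ : Tor (cubeSide (d := d) M₀ L m) → ℝ) :
    kingFreeChi L M₀ b₀ p m φ * |kingFreeS L M₀ a msq m k φ - kingFreeS L M₀ a msq m (k + n) φ|
      ≤ thm34Const a L msq b₀ p d * ((L : ℝ) ^ (-((1 : ℝ) / 2 * k)) * eps L m ^ (-((d : ℝ) + 2 * p + 2)) + eps L m ^ (1 : ℝ)) * (M₀ : ℝ) ^ d := by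
  have hε : 0 < eps L m := eps_pos (by omega) m
  have hΘ := thetaUnif_pos ha hL
  have h1L := one_sub_invSq_pos hL
  have hamin : 0 < a * (1 - ((L : ℝ) ^ 2)⁻¹) := mul_pos ha h1L
  have hΛ0 : 0 < lambda0 a L msq d := by unfold lambda0; positivity
  have hd0 : (0 : ℝ) ≤ 4 * d := by positivity
  have hC0 : 0 ≤ thm34Const a L msq b₀ p d := by unfold thm34Const; positivity
  have hrate0 : 0 ≤ (L : ℝ) ^ (-((1 : ℝ) / 2 * k)) := Real.rpow_nonneg (Nat.cast_nonneg L) _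
  have hεβ0 : 0 ≤ eps L m ^ (-((d : ℝ) + 2 * p + 2)) := Real.rpow_nonneg hε.le _
  have hε10 : 0 ≤ eps L m ^ (1 : ℝ) := Real.rpow_nonneg hε.le _
  have hRHS0 : 0 ≤ thm34Const a L msq b₀ p d * ((L : ℝ) ^ (-((1 : ℝ) / 2 * k)) * eps L m ^ (-((d : ℝ) + 2 * p + 2)) + eps L m ^ (1 : ℝ))
      * (M₀ : ℝ) ^ d := by positivity
  rcases kingFreeChi_zero_or_one L M₀ b₀ p m φ with hχ | hχ
  · rw [hχ, zero_mul]; exact hRHS0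
  rw [hχ, one_mul]
  rcases Nat.eq_zero_or_pos n with hn | hn
  · subst hn; rw [add_zero, sub_self, abs_zero]; exact hRHS0
  have hmono : ∀ {X : ℝ}, X ≤ thm34Const a L msq b₀ p d * ((L : ℝ) ^ (-((1 : ℝ) / 2 * k)) * eps L m ^ (-((d : ℝ) + 2 * p + 2))) * (M₀ : ℝ) ^ d →
      X ≤ thm34Const a L msq b₀ p d * ((L : ℝ) ^ (-((1 : ℝ) / 2 * k)) * eps L m ^ (-((d : ℝ) + 2 * p + 2)) + eps L m ^ (1 : ℝ)) * (M₀ : ℝ) ^ d :=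
    fun {X} h => h.trans (by
      apply mul_le_mul_of_nonneg_right _ (by positivity)
      exact mul_le_mul_of_nonneg_left (le_add_of_nonneg_right hε10) hC0)
  rcases Nat.eq_zero_or_pos k with hk | hk
  · subst hk
    apply hmono
    have h := thm34_member_zero (d := d) L M₀ ha hL hmsq hb hp m hn hχ
    rw [zero_add]
    have hrate1 : (L : ℝ) ^ (-((1 : ℝ) / 2 * ((0 : ℕ) : ℝ))) = 1 := by simp
    rw [hrate1, one_mul]
    exact h
  · exact hmono (thm34_member_rate (d := d) L M₀ ha hL hmsq hb hp m hk hn hχ)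

/-- ★★★ **[King1986] THEOREM 3.4 (3.9) BY NAME FOR THE FREE MASSIVE LATTICE SCALAR FIELD AT `A = 0`**: for `L ≥ 2`, `a, m², b₀ > 0`, `p ≥ 0`, every
dimension `d` and every cubic torus `|T| = M₀^d`, the datum `kingFreeRG L M₀ a m² b₀ p` of part Τ-e satisfies the typer's schema `RGData.Thm34Printed`:
there are `0 < γ < 1`, `σ, β > 0`, `C` with `χ_k(φ_k)|S^{(k),1}(T₁^{(k)}, φ_k) − S^{(k+n),1}(T₁^{(k)}, φ_k)| ≤ C(L^{−γk}(L^kε_K)^{−β} + (L^kε_K)^σ)|T|` for ALL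
`K ≥ k ≥ 0`, `n ≥ 0`, `φ_k` — here `γ = ½`, `σ = 1`, `β = d + 2p + 2`, `C = thm34Const`.  King's §3.6 route ((3.91) as forms ⇒ (3.92), and (3.93) by
the determinant-free log-comparison of part Τ-a). [cite: King1986, Thm 3.4 (3.9) p.656, Prop. 3.10 (3.91)–(3.93) pp.668–669] -/
theorem thm34Printed_kingFreeRG (hL : 2 ≤ L) {a msq b₀ p : ℝ} (ha : 0 < a) (hmsq : 0 < msq) (hb : 0 < b₀) (hp : 0 ≤ p) :
    (kingFreeRG (d := d) L M₀ a msq b₀ p).Thm34Printed :=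
  ⟨1 / 2, 1, (d : ℝ) + 2 * p + 2, thm34Const a L msq b₀ p d, by norm_num, by norm_num, by norm_num,
    by have : (0 : ℝ) ≤ d := Nat.cast_nonneg d; linarith,
    fun m k n φ => thm34_bound (d := d) L M₀ ha hL hmsq hb.le hp m k n φ⟩

end Main

end Summit.QuantumFields.YangMills.BalabanUVNodes.N15KingModelRung.FreeField

end
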